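import Summits.CriticalPhenomena.SAWScalingLimit.Theorems.SAWDefectDecoherenceObservableToSLERCarvedDictionaryWalks
import Summits.CriticalPhenomena.SAWScalingLimit.Theorems.SAWDefectDecoherenceObservableToSLERGateDefs
import HarnessLib

/-!
# Crux `SAWDevelopingMap.ObservableToSLE` (stmt-CriticalPhenomena-10472), line `six-class-type-ladder`,
stub T2b `stub_carvedReduction` (= twin stub 5a4 of stmt-CriticalPhenomena-14005): piece (G5b),
EXACT SUB-DOMAIN CONDITIONING of the carved law

Landing target:
`Summits/CriticalPhenomena/SAWScalingLimit/Theorems/SAWDevelopingMapObservableToSLETypeLadderCarvedReductionConditioning.lean`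
(`--supports stmt-CriticalPhenomena-10472`; registered sub-goal `stub_carvedReduction_conditioning`).

The moving-carving reduction (T2b) compares the carved critical law
`carvedLaw Ω δ S q q' = Z⁻¹ • carvedWeight Ω δ S q q'` (vertex self-avoiding walks of `Ω_δ` from
`q` to `q'` avoiding the removed set `S`) with the Duminil-Copin–Smirnov ratio sums of a SMALLER
vertex domain `Λ' ∌ S` (the natural lattice family of an inner Jordan approximant), to which the
fixed-domain identification T2a applies.  This file is the dictionary for that step, on a
SUB-FAMILY CELL: `Λ'` misses `S`, contains the root `q`, every honeycomb edge inside `Λ'` is an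
edge of `Ω_δ` (no bad edge INSIDE `Λ'` — dischargeable for inner approximants, unlike for the
full carved set), the gate vertices `p, p'` lie in `S`, `q ∼ p`, and the two gate mid-edges differ.
No hypothesis relates `Λ'` to the full carved vertex set.  Contents: the sub-family bijection with
`HexMidEdgeSAW Λ' s(q,p) s(q',p')` (same vertex lists; the carved-cell bijection of
`…CarvedDictionaryWalks` for the removed set `S ∪ Λ'ᶜ`); carved weights / sums / integrals over
`{support ⊆ Λ'}` as DCS partition sums of `Λ'`; THE CONDITIONING IDENTITY
`∫_{⊆ Λ'} g(support) dP = P(⊆ Λ') · (Σ_γ x_c^{ℓ(γ)} g(γ.verts)) / Z_{Λ'}` with `P(⊆ Λ') = Z_{Λ'}/Z`;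
the bound `|∫ f∘curve dP − DCS-average_{Λ'}(f)| ≤ 2‖f‖ (1 − P(⊆ Λ'))`; and the event transfer
`P(curve ∉ 𝒞) ≤ η P(⊆ Λ') ⟹ Σ_{γ : curve ∉ 𝒞} x_c^{ℓ(γ)} ≤ η Z_{Λ'}` (tightness / injectivity
modulus of the carved laws pass to the conditioned DCS laws); `stub_carvedReduction_conditioning`
packages the last three.  Sources: H. Duminil-Copin, S. Smirnov, Ann. of Math. 175 (2012)
(arXiv:1007.0575) §1–2, §4; G. Lawler, O. Schramm, W. Werner, Proc. Sympos. Pure Math. 72 (2004)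
§3.4 (sub-domain conditioning = restriction property of the SAW).
-/

noncomputable section
noncomputable section

open scoped BigOperators Topology NNReal ENNReal Classical BoundedContinuousFunction
open Filter Set MeasureTheory Metric
open Literature.Probability.LatticeModels (HexVertex hexGraph hexCenter triZeta Site polyline)
open Literature.Probability.RandomPlanarGeometry
open Literature.Probability.RandomPlanarGeometry.SAW

namespace Summit.CriticalPhenomena.SAWScalingLimit.Theorems.ObservableToSLE.TypeLadder

open Summit.CriticalPhenomena.SAWScalingLimit.Theorems.ObservableToSLER.BridgeGate

/-- The carved curve of a walk IS the Duminil-Copin–Smirnov polyline of its vertex list. -/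
theorem curve_eq_mk_polyline {Ω : Set ℂ} {δ : ℝ} {u v : HexVertex} (ξ : HexDomainSAW Ω δ u v) :
    ξ.curve = CurveClass.mk ⟨polyline (ξ.walk.support.map fun w => (δ : ℂ) * hexCenter w)⟩ :=
  rfl

/-- Avoiding `S ∪ Λ'ᶜ` is staying inside `Λ'`, when `Λ'` misses `S`. -/
theorem forall_notMem_union_compl_iff {S : Set HexVertex} {Λ' : Finset HexVertex}
    (hΛ'S : ∀ x ∈ Λ', x ∉ S) (l : List HexVertex) :
    (∀ x ∈ l, x ∉ S ∪ (↑Λ' : Set HexVertex)ᶜ) ↔ ∀ x ∈ l, x ∈ Λ' := by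
  refine ⟨fun h x hx => ?_, fun h x hx => ?_⟩
  · have h' := h x hx
    simp only [Set.mem_union, Set.mem_compl_iff, Finset.mem_coe, not_or, not_not] at h'
    exact h'.2
  · simp only [Set.mem_union, Set.mem_compl_iff, Finset.mem_coe, not_or, not_not]
    exact ⟨hΛ'S x (h x hx), h x hx⟩

section SubFamily

variable {Ω : Set ℂ} {δ : ℝ} {S : Set HexVertex} {Λ' : Finset HexVertex} {u v pu pv : HexVertex}

/-! The standing hypotheses of a SUB-FAMILY CELL: `Λ'` misses the removed set `S` (`hΛ'S`), every
honeycomb edge inside `Λ'` is an edge of `Ω_δ` (`hedge`), the root `u ∈ Λ'` (`hu`), the gate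
vertices `pu, pv ∈ S` (`hpu`, `hpv`), the root gate `u ∼ pu` (`hadj`), distinct gate mid-edges
(`hne`).  In the line: `u = q k`, `pu = p`, `v = q' k`, `pv = p'`, `S = S k (n k) ∪ T k (n' k)`. -/

variable (hΛ'S : ∀ x ∈ Λ', x ∉ S)
  (hedge : ∀ x ∈ Λ', ∀ y ∈ Λ', hexGraph.Adj x y → (hexDomainGraph Ω δ).Adj x y)
  (hu : u ∈ Λ') (hpu : pu ∈ S) (hpv : pv ∈ S) (hadj : hexGraph.Adj u pu)
  (hne : s(u, pu) ≠ s(v, pv))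

include hΛ'S hedge hu hpu hpv hadj hne

/-- **The sub-family bijection.**  The walks of `Ω_δ` from `u` to `v` staying inside `Λ'` are in
bijection with the mid-edge walks of `Λ'` from `s(u, pu)` to `s(v, pv)`, with the same vertex
lists (the carved-cell bijection for the removed set `S ∪ Λ'ᶜ`). -/
theorem exists_equiv_subfamily :
    ∃ e : {ξ : HexDomainSAW Ω δ u v // ∀ x ∈ ξ.walk.support, x ∈ Λ'} ≃
        HexMidEdgeSAW Λ' s(u, pu) s(v, pv), ∀ ξ, (e ξ).verts = ξ.1.walk.support := by
  have hΛ : ∀ (w : HexVertex) (π : (hexDomainGraph Ω δ).Walk u w),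
      (∀ x ∈ π.support, x ∉ S ∪ (↑Λ' : Set HexVertex)ᶜ) → ∀ x ∈ π.support, x ∈ Λ' :=
    fun w π h => (forall_notMem_union_compl_iff hΛ'S _).1 h
  have hΛS : ∀ x ∈ Λ', x ∉ S ∪ (↑Λ' : Set HexVertex)ᶜ := fun x hx => by
    simp only [Set.mem_union, Set.mem_compl_iff, Finset.mem_coe, not_or, not_not]
    exact ⟨hΛ'S x hx, hx⟩
  obtain ⟨e, he⟩ := exists_equiv_avoid_hexMidEdgeSAW hΛ hΛS hedge (hΛS u hu) (Or.inl hpu)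
    (Or.inl hpv) hadj hne
  let e₀ : {ξ : HexDomainSAW Ω δ u v // ∀ x ∈ ξ.walk.support, x ∈ Λ'} ≃
      {ξ : HexDomainSAW Ω δ u v // ∀ x ∈ ξ.walk.support, x ∉ S ∪ (↑Λ' : Set HexVertex)ᶜ} :=
    Equiv.subtypeEquivRight fun ξ => (forall_notMem_union_compl_iff hΛ'S _).symm
  exact ⟨e₀.trans e, fun ξ => by rw [Equiv.trans_apply, he]; rfl⟩

/-- **Carved weights on the sub-family are DCS partition sums of `Λ'`**: the carved weight of the
walks staying in `Λ'` with vertex list in `B` is `Σ_{γ ⊂ Λ' : s(u,pu) → s(v,pv), verts ∈ B} x_c^{ℓ(γ)}`. -/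
theorem carvedWeight_subfamily_apply [Fintype (HexDomainSAW Ω δ u v)] (B : Set (List HexVertex)) :
    carvedWeight Ω δ S u v {ξ | (∀ x ∈ ξ.walk.support, x ∈ Λ') ∧ ξ.walk.support ∈ B} =
      ∑ γ : HexMidEdgeSAW Λ' s(u, pu) s(v, pv),
        if γ.verts ∈ B then ENNReal.ofReal (hexCriticalFugacity ^ γ.length) else 0 := by
  have hΛ : ∀ (w : HexVertex) (π : (hexDomainGraph Ω δ).Walk u w),
      (∀ x ∈ π.support, x ∉ S ∪ (↑Λ' : Set HexVertex)ᶜ) → ∀ x ∈ π.support, x ∈ Λ' :=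
    fun w π h => (forall_notMem_union_compl_iff hΛ'S _).1 h
  have hΛS : ∀ x ∈ Λ', x ∉ S ∪ (↑Λ' : Set HexVertex)ᶜ := fun x hx => by
    simp only [Set.mem_union, Set.mem_compl_iff, Finset.mem_coe, not_or, not_not]
    exact ⟨hΛ'S x hx, hx⟩
  have h := restrict_avoid_apply_eq_sum hΛ hΛS hedge (hΛS u hu) (Or.inl hpu) (Or.inl hpv)
    hadj hne B
  rw [Measure.restrict_apply MeasurableSpace.measurableSet_top] at h
  rw [carvedWeight, Measure.restrict_apply MeasurableSpace.measurableSet_top, ← h]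
  congr 1
  ext ξ
  simp only [Set.mem_inter_iff, Set.mem_setOf_eq]
  rw [forall_notMem_union_compl_iff hΛ'S]
  constructor
  · rintro ⟨⟨h1, h2⟩, -⟩
    exact ⟨h2, h1⟩
  · rintro ⟨h2, h1⟩
    exact ⟨⟨h1, h2⟩, fun x hx => hΛ'S x (h1 x hx)⟩

/-- **Sums over the sub-family are DCS sums of `Λ'`**, for every function `g` of the vertex list. -/
theorem sum_subfamily_eq_sum [Fintype (HexDomainSAW Ω δ u v)] (g : List HexVertex → ℝ) :
    ∑ ξ ∈ Finset.univ.filter (fun ξ : HexDomainSAW Ω δ u v => ∀ x ∈ ξ.walk.support, x ∈ Λ'),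
        hexCriticalFugacity ^ ξ.vertexCount * g ξ.walk.support =
      ∑ γ : HexMidEdgeSAW Λ' s(u, pu) s(v, pv), hexCriticalFugacity ^ γ.length * g γ.verts := by
  obtain ⟨e, he⟩ := exists_equiv_subfamily hΛ'S hedge hu hpu hpv hadj hne
  rw [Finset.sum_subtype (p := fun ξ : HexDomainSAW Ω δ u v => ∀ x ∈ ξ.walk.support, x ∈ Λ')
      (Finset.univ.filter fun ξ : HexDomainSAW Ω δ u v => ∀ x ∈ ξ.walk.support, x ∈ Λ')
      (fun ξ => by rw [Finset.mem_filter]; exact ⟨fun h => h.2, fun h => ⟨Finset.mem_univ _, h⟩⟩)]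
  refine Fintype.sum_equiv e _ _ fun ξ => ?_
  have hlen : (e ξ).length = ξ.1.vertexCount := by
    rw [HexMidEdgeSAW.length, he, SimpleGraph.Walk.length_support]
    rfl
  rw [hlen, he]

omit hΛ'S hedge hu hpu hpv hadj hne in
/-- The carved weight is a finite measure (finitely many walks). -/
theorem isFiniteMeasure_carvedWeight [Fintype (HexDomainSAW Ω δ u v)] :
    IsFiniteMeasure (carvedWeight Ω δ S u v) := by
  refine ⟨lt_of_le_of_lt (Measure.restrict_apply_le _ _) ?_⟩
  rw [ObservableToSLE.FloorRatio.embWeight_apply_eq_sum]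
  exact ENNReal.sum_lt_top.2 fun _ _ => ENNReal.ofReal_lt_top

omit hΛ'S hedge hu hpu hpv hadj hne in
/-- The mass of a single walk under the carved weight restricted to the sub-family event. -/
theorem carvedWeight_restrict_real_singleton [Fintype (HexDomainSAW Ω δ u v)]
    (hΛ'S : ∀ x ∈ Λ', x ∉ S) (ξ : HexDomainSAW Ω δ u v) :
    ((carvedWeight Ω δ S u v).restrict {ξ | ∀ x ∈ ξ.walk.support, x ∈ Λ'}).real {ξ} =
      if ∀ x ∈ ξ.walk.support, x ∈ Λ' then hexCriticalFugacity ^ ξ.vertexCount else 0 := by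
  rw [measureReal_def, Measure.restrict_apply MeasurableSpace.measurableSet_top, carvedWeight,
    Measure.restrict_apply MeasurableSpace.measurableSet_top, Set.inter_assoc]
  by_cases h : ∀ x ∈ ξ.walk.support, x ∈ Λ'
  · rw [if_pos h, Set.singleton_inter_of_mem (show ξ ∈ {ξ : HexDomainSAW Ω δ u v |
        ∀ x ∈ ξ.walk.support, x ∈ Λ'} ∩ {ξ | ∀ x ∈ ξ.walk.support, x ∉ S} from
        ⟨h, fun x hx => hΛ'S x (h x hx)⟩), hexSAWWeight_singleton,
      ENNReal.toReal_ofReal (pow_nonneg hexCriticalFugacity_pos_lt_one.1.le _)]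
  · rw [if_neg h, Set.singleton_inter_eq_empty.2 (fun h' => h h'.1), measure_empty,
      ENNReal.toReal_zero]

/-- **Integrals over the sub-family against the carved weight are DCS sums of `Λ'`.** -/
theorem setIntegral_carvedWeight_subfamily [Fintype (HexDomainSAW Ω δ u v)] (g : List HexVertex → ℝ) :
    ∫ ξ in {ξ | ∀ x ∈ ξ.walk.support, x ∈ Λ'}, g ξ.walk.support ∂(carvedWeight Ω δ S u v) =
      ∑ γ : HexMidEdgeSAW Λ' s(u, pu) s(v, pv), hexCriticalFugacity ^ γ.length * g γ.verts := by
  haveI := isFiniteMeasure_carvedWeight (Ω := Ω) (δ := δ) (S := S) (u := u) (v := v)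
  rw [integral_fintype (Integrable.of_finite), ← sum_subfamily_eq_sum hΛ'S hedge hu hpu hpv hadj hne g,
    Finset.sum_filter]
  refine Finset.sum_congr rfl fun ξ _ => ?_
  rw [carvedWeight_restrict_real_singleton hΛ'S ξ]
  split_ifs <;> simp

/-- **The carved probability of staying in `Λ'` is `Z_{Λ'} / Z`.** -/
theorem carvedLaw_subfamily_apply [Fintype (HexDomainSAW Ω δ u v)] :
    carvedLaw Ω δ S u v {ξ | ∀ x ∈ ξ.walk.support, x ∈ Λ'} =
      (carvedWeight Ω δ S u v Set.univ)⁻¹ *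
        ENNReal.ofReal (∑ γ : HexMidEdgeSAW Λ' s(u, pu) s(v, pv), hexCriticalFugacity ^ γ.length) := by
  have h := carvedWeight_subfamily_apply hΛ'S hedge hu hpu hpv hadj hne Set.univ
  simp only [Set.mem_univ, and_true, if_true] at h
  rw [carvedLaw, Measure.smul_apply, smul_eq_mul, h,
    ENNReal.ofReal_sum_of_nonneg fun _ _ => pow_nonneg hexCriticalFugacity_pos_lt_one.1.le _]

/-- The same, in real numbers. -/
theorem carvedLaw_subfamily_real [Fintype (HexDomainSAW Ω δ u v)] :
    (carvedLaw Ω δ S u v {ξ | ∀ x ∈ ξ.walk.support, x ∈ Λ'}).toReal =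
      ((carvedWeight Ω δ S u v Set.univ)⁻¹).toReal *
        ∑ γ : HexMidEdgeSAW Λ' s(u, pu) s(v, pv), hexCriticalFugacity ^ γ.length := by
  rw [carvedLaw_subfamily_apply hΛ'S hedge hu hpu hpv hadj hne, ENNReal.toReal_mul,
    ENNReal.toReal_ofReal (Finset.sum_nonneg fun _ _ =>
      pow_nonneg hexCriticalFugacity_pos_lt_one.1.le _)]

/-- **Integrals over the sub-family against the carved LAW.** -/
theorem setIntegral_carvedLaw_subfamily [Fintype (HexDomainSAW Ω δ u v)] (g : List HexVertex → ℝ) :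
    ∫ ξ in {ξ | ∀ x ∈ ξ.walk.support, x ∈ Λ'}, g ξ.walk.support ∂(carvedLaw Ω δ S u v) =
      ((carvedWeight Ω δ S u v Set.univ)⁻¹).toReal *
        ∑ γ : HexMidEdgeSAW Λ' s(u, pu) s(v, pv), hexCriticalFugacity ^ γ.length * g γ.verts := by
  rw [carvedLaw, Measure.restrict_smul, integral_smul_measure,
    setIntegral_carvedWeight_subfamily hΛ'S hedge hu hpu hpv hadj hne g, smul_eq_mul]

/-- **THE CONDITIONING IDENTITY.**  The carved law conditioned on staying in `Λ'` is the
Duminil-Copin–Smirnov law of `(Λ'; s(u,pu), s(v,pv))`: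
`∫_{⊆ Λ'} g(support) dP = P(⊆ Λ') · (Σ_γ x_c^{ℓ(γ)} g(γ.verts)) / (Σ_γ x_c^{ℓ(γ)})`. -/
theorem setIntegral_carvedLaw_subfamily_eq_mul_div [Fintype (HexDomainSAW Ω δ u v)]
    (g : List HexVertex → ℝ) (hne' : Nonempty (HexMidEdgeSAW Λ' s(u, pu) s(v, pv))) :
    ∫ ξ in {ξ | ∀ x ∈ ξ.walk.support, x ∈ Λ'}, g ξ.walk.support ∂(carvedLaw Ω δ S u v) =
      (carvedLaw Ω δ S u v {ξ | ∀ x ∈ ξ.walk.support, x ∈ Λ'}).toReal *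
        ((∑ γ : HexMidEdgeSAW Λ' s(u, pu) s(v, pv), hexCriticalFugacity ^ γ.length * g γ.verts) /
          ∑ γ : HexMidEdgeSAW Λ' s(u, pu) s(v, pv), hexCriticalFugacity ^ γ.length) := by
  have hZ : (0 : ℝ) < ∑ γ : HexMidEdgeSAW Λ' s(u, pu) s(v, pv), hexCriticalFugacity ^ γ.length := by
    obtain ⟨γ⟩ := hne'
    exact lt_of_lt_of_le (pow_pos hexCriticalFugacity_pos_lt_one.1 γ.length)
      (Finset.single_le_sum (f := fun γ : HexMidEdgeSAW Λ' s(u, pu) s(v, pv) =>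
        hexCriticalFugacity ^ γ.length) (fun γ _ => pow_nonneg hexCriticalFugacity_pos_lt_one.1.le _)
        (Finset.mem_univ γ))
  rw [setIntegral_carvedLaw_subfamily hΛ'S hedge hu hpu hpv hadj hne,
    carvedLaw_subfamily_real hΛ'S hedge hu hpu hpv hadj hne, mul_assoc, mul_div_cancel₀ _ hZ.ne']

/-- **Conditioning moves the `f`-integral by at most `2‖f‖ (1 − P(⊆ Λ'))`**: for a probability
carved law and a bounded continuous `f` on curve classes,
`|∫ f∘curve dP − (Σ_γ x_c^{ℓ(γ)} f(polyline γ)) / (Σ_γ x_c^{ℓ(γ)})| ≤ 2 ‖f‖ (1 − P(⊆ Λ'))`. -/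
theorem abs_integral_curve_sub_div_le [Fintype (HexDomainSAW Ω δ u v)]
    [IsProbabilityMeasure (carvedLaw Ω δ S u v)] (f : CurveClass ℂ →ᵇ ℝ)
    (hne' : Nonempty (HexMidEdgeSAW Λ' s(u, pu) s(v, pv))) :
    |(∫ ξ, f ξ.curve ∂(carvedLaw Ω δ S u v)) -
        (∑ γ : HexMidEdgeSAW Λ' s(u, pu) s(v, pv), hexCriticalFugacity ^ γ.length *
            f (CurveClass.mk ⟨polyline (γ.verts.map fun w => (δ : ℂ) * hexCenter w)⟩)) /
          ∑ γ : HexMidEdgeSAW Λ' s(u, pu) s(v, pv), hexCriticalFugacity ^ γ.length| ≤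
      2 * ‖f‖ * (1 - (carvedLaw Ω δ S u v {ξ | ∀ x ∈ ξ.walk.support, x ∈ Λ'}).toReal) := by
  set P := carvedLaw Ω δ S u v with hP
  set A : Set (HexDomainSAW Ω δ u v) := {ξ | ∀ x ∈ ξ.walk.support, x ∈ Λ'} with hA
  set g : List HexVertex → ℝ := fun l =>
    f (CurveClass.mk ⟨polyline (l.map fun w => (δ : ℂ) * hexCenter w)⟩) with hg
  set Z' := ∑ γ : HexMidEdgeSAW Λ' s(u, pu) s(v, pv), hexCriticalFugacity ^ γ.length with hZ'
  set N := ∑ γ : HexMidEdgeSAW Λ' s(u, pu) s(v, pv), hexCriticalFugacity ^ γ.length * g γ.verts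
    with hN
  have hx : ∀ n : ℕ, 0 ≤ hexCriticalFugacity ^ n := fun n =>
    pow_nonneg hexCriticalFugacity_pos_lt_one.1.le n
  have hZpos : 0 < Z' := by
    obtain ⟨γ⟩ := hne'
    exact lt_of_lt_of_le (pow_pos hexCriticalFugacity_pos_lt_one.1 γ.length)
      (Finset.single_le_sum (f := fun γ : HexMidEdgeSAW Λ' s(u, pu) s(v, pv) =>
        hexCriticalFugacity ^ γ.length) (fun γ _ => hx _) (Finset.mem_univ γ))
  -- the DCS average is bounded by `‖f‖`
  have havg : |N / Z'| ≤ ‖f‖ := by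
    rw [abs_div, abs_of_pos hZpos, div_le_iff₀ hZpos]
    calc |N| ≤ ∑ γ : HexMidEdgeSAW Λ' s(u, pu) s(v, pv), |hexCriticalFugacity ^ γ.length * g γ.verts| :=
          Finset.abs_sum_le_sum_abs _ _
      _ ≤ ∑ γ : HexMidEdgeSAW Λ' s(u, pu) s(v, pv), hexCriticalFugacity ^ γ.length * ‖f‖ := by
          refine Finset.sum_le_sum fun γ _ => ?_
          rw [abs_mul, abs_of_nonneg (hx _)]
          exact mul_le_mul_of_nonneg_left ((Real.norm_eq_abs _).symm.le.trans (f.norm_coe_le_norm _))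
            (hx _)
      _ = ‖f‖ * Z' := by rw [hZ', Finset.mul_sum]; exact Finset.sum_congr rfl fun _ _ => mul_comm _ _
  -- split the integral along `A`
  have hfi : Integrable (fun ξ : HexDomainSAW Ω δ u v => f ξ.curve) P := Integrable.of_finite
  have hsplit := integral_add_compl (μ := P) (s := A) MeasurableSpace.measurableSet_top hfi
  have hin : ∫ ξ in A, f ξ.curve ∂P = (P A).toReal * (N / Z') := by
    have := setIntegral_carvedLaw_subfamily_eq_mul_div hΛ'S hedge hu hpu hpv hadj hne g hne'
    exact this
  have hout : |∫ ξ in Aᶜ, f ξ.curve ∂P| ≤ ‖f‖ * (1 - (P A).toReal) := by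
    have h1 : ‖∫ ξ in Aᶜ, f ξ.curve ∂P‖ ≤ ‖f‖ * (P Aᶜ).toReal :=
      calc ‖∫ ξ in Aᶜ, f ξ.curve ∂P‖ ≤ ‖f‖ * P.real Aᶜ :=
            norm_setIntegral_le_of_norm_le_const (measure_lt_top P _)
              (fun ξ _ => f.norm_coe_le_norm ξ.curve)
        _ = ‖f‖ * (P Aᶜ).toReal := by rw [measureReal_def]
    rw [Real.norm_eq_abs] at h1
    refine h1.trans (le_of_eq ?_)
    rw [prob_compl_eq_one_sub MeasurableSpace.measurableSet_top, ENNReal.toReal_sub_of_le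
      prob_le_one ENNReal.one_ne_top, ENNReal.toReal_one]
  have hPA : (P A).toReal ≤ 1 := ENNReal.toReal_le_of_le_ofReal zero_le_one
    (by rw [ENNReal.ofReal_one]; exact prob_le_one)
  rw [← hsplit, hin]
  have key : (P A).toReal * (N / Z') + ∫ ξ in Aᶜ, f ξ.curve ∂P - N / Z' =
      ((P A).toReal - 1) * (N / Z') + ∫ ξ in Aᶜ, f ξ.curve ∂P := by ring
  rw [key]
  calc |((P A).toReal - 1) * (N / Z') + ∫ ξ in Aᶜ, f ξ.curve ∂P|
      ≤ |((P A).toReal - 1) * (N / Z')| + |∫ ξ in Aᶜ, f ξ.curve ∂P| := abs_add_le _ _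
    _ ≤ (1 - (P A).toReal) * ‖f‖ + ‖f‖ * (1 - (P A).toReal) := by
        refine add_le_add ?_ hout
        rw [abs_mul, abs_sub_comm, abs_of_nonneg (by linarith)]
        exact mul_le_mul_of_nonneg_left havg (by linarith)
    _ = 2 * ‖f‖ * (1 - (P A).toReal) := by ring

/-- **Event transfer to the DCS sums of `Λ'`.**  For any set `𝒞` of curve classes and `η ≥ 0`:
if the carved law gives the event `curve ∉ 𝒞` mass at most `η · P(⊆ Λ')`, then the DCS weight of
the walks of `Λ'` whose polyline is not in `𝒞` is at most `η · Z_{Λ'}` (tightness and injectivity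
modulus of the carved laws pass to the conditioned laws). -/
theorem sum_ite_notMem_le_of_carvedLaw_le [Fintype (HexDomainSAW Ω δ u v)]
    [IsProbabilityMeasure (carvedLaw Ω δ S u v)] (𝒞 : Set (CurveClass ℂ)) {η : ℝ} (hη : 0 ≤ η)
    (h : carvedLaw Ω δ S u v {ξ | ξ.curve ∉ 𝒞} ≤
      ENNReal.ofReal η * carvedLaw Ω δ S u v {ξ | ∀ x ∈ ξ.walk.support, x ∈ Λ'}) :
    (∑ γ : HexMidEdgeSAW Λ' s(u, pu) s(v, pv),
        if CurveClass.mk ⟨polyline (γ.verts.map fun w => (δ : ℂ) * hexCenter w)⟩ ∉ 𝒞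
        then hexCriticalFugacity ^ γ.length else 0) ≤
      η * ∑ γ : HexMidEdgeSAW Λ' s(u, pu) s(v, pv), hexCriticalFugacity ^ γ.length := by
  have hx : ∀ n : ℕ, 0 ≤ hexCriticalFugacity ^ n := fun n =>
    pow_nonneg hexCriticalFugacity_pos_lt_one.1.le n
  set Z := carvedWeight Ω δ S u v Set.univ with hZ
  have hZ0 : Z ≠ 0 := by
    intro h0
    have h1 : carvedLaw Ω δ S u v Set.univ = 1 := measure_univ
    rw [carvedLaw, Measure.smul_apply, smul_eq_mul, ← hZ, h0, mul_zero] at h1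
    exact zero_ne_one h1
  have hZtop : Z ≠ ∞ := by
    intro ht
    have h1 : carvedLaw Ω δ S u v Set.univ = 1 := measure_univ
    rw [carvedLaw, Measure.smul_apply, smul_eq_mul, ← hZ, ht, ENNReal.inv_top, zero_mul] at h1
    exact zero_ne_one h1
  -- un-normalise the hypothesis
  have hcancel : ∀ X : ℝ≥0∞, Z * (Z⁻¹ * X) = X := fun X => by
    rw [← mul_assoc, ENNReal.mul_inv_cancel hZ0 hZtop, one_mul]
  have h' : carvedWeight Ω δ S u v {ξ | ξ.curve ∉ 𝒞} ≤
      ENNReal.ofReal η * carvedWeight Ω δ S u v {ξ | ∀ x ∈ ξ.walk.support, x ∈ Λ'} := by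
    have h2 : Z⁻¹ * carvedWeight Ω δ S u v {ξ | ξ.curve ∉ 𝒞} ≤
        ENNReal.ofReal η * (Z⁻¹ * carvedWeight Ω δ S u v {ξ | ∀ x ∈ ξ.walk.support, x ∈ Λ'}) := by
      simpa only [carvedLaw, Measure.smul_apply, smul_eq_mul] using h
    calc carvedWeight Ω δ S u v {ξ | ξ.curve ∉ 𝒞}
        = Z * (Z⁻¹ * carvedWeight Ω δ S u v {ξ | ξ.curve ∉ 𝒞}) := (hcancel _).symm
      _ ≤ Z * (ENNReal.ofReal η * (Z⁻¹ * carvedWeight Ω δ S u v {ξ | ∀ x ∈ ξ.walk.support, x ∈ Λ'})) :=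
          mul_le_mul_right h2 Z
      _ = ENNReal.ofReal η * carvedWeight Ω δ S u v {ξ | ∀ x ∈ ξ.walk.support, x ∈ Λ'} := by
          rw [mul_left_comm, hcancel]
  -- the sub-family part of the bad event, as a DCS sum
  have hB := carvedWeight_subfamily_apply hΛ'S hedge hu hpu hpv hadj hne
    {l | CurveClass.mk ⟨polyline (l.map fun w => (δ : ℂ) * hexCenter w)⟩ ∉ 𝒞}
  have hmono : carvedWeight Ω δ S u v {ξ | (∀ x ∈ ξ.walk.support, x ∈ Λ') ∧ ξ.walk.support ∈
      {l | CurveClass.mk ⟨polyline (l.map fun w => (δ : ℂ) * hexCenter w)⟩ ∉ 𝒞}} ≤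
      carvedWeight Ω δ S u v {ξ | ξ.curve ∉ 𝒞} := by
    refine measure_mono fun ξ hξ => ?_
    rw [Set.mem_setOf_eq, curve_eq_mk_polyline]
    exact hξ.2
  have hU := carvedWeight_subfamily_apply hΛ'S hedge hu hpu hpv hadj hne Set.univ
  simp only [Set.mem_univ, and_true, if_true] at hU
  have hfin := (hB.symm.le.trans hmono).trans h'
  rw [hU, ← ENNReal.ofReal_sum_of_nonneg (fun _ _ => hx _), ← ENNReal.ofReal_mul hη] at hfin
  have hlhs : ENNReal.ofReal (∑ γ : HexMidEdgeSAW Λ' s(u, pu) s(v, pv),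
        if CurveClass.mk ⟨polyline (γ.verts.map fun w => (δ : ℂ) * hexCenter w)⟩ ∉ 𝒞
        then hexCriticalFugacity ^ γ.length else 0) ≤
      ENNReal.ofReal (η * ∑ γ : HexMidEdgeSAW Λ' s(u, pu) s(v, pv), hexCriticalFugacity ^ γ.length) := by
    refine le_trans (le_of_eq ?_) hfin
    rw [ENNReal.ofReal_sum_of_nonneg (fun γ _ => by split_ifs <;> simp [hx])]
    refine Finset.sum_congr rfl fun γ _ => ?_
    by_cases hγ : CurveClass.mk ⟨polyline (γ.verts.map fun w => (δ : ℂ) * hexCenter w)⟩ ∈ 𝒞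
    · have h1 : ¬ (γ.verts ∈
          {l | CurveClass.mk ⟨polyline (l.map fun w => (δ : ℂ) * hexCenter w)⟩ ∉ 𝒞}) :=
        fun h1 => h1 hγ
      rw [if_neg (not_not.2 hγ), if_neg h1, ENNReal.ofReal_zero]
    · have h1 : γ.verts ∈
          {l | CurveClass.mk ⟨polyline (l.map fun w => (δ : ℂ) * hexCenter w)⟩ ∉ 𝒞} := hγ
      rw [if_pos hγ, if_pos h1]
  exact (ENNReal.ofReal_le_ofReal_iff (mul_nonneg hη (Finset.sum_nonneg fun _ _ => hx _))).1 hlhs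

end SubFamily

/-- **Registered sub-goal `stub_carvedReduction_conditioning`** (crux item
stmt-CriticalPhenomena-10472, stub T2b `stub_carvedReduction`, piece (G5b) EXACT SUB-DOMAIN
CONDITIONING): on a sub-family cell `Λ'` of the carved law `carvedLaw Ω δ S u v` (probability,
finitely many walks), (1) `P(⊆ Λ') = Z_{Λ'}(s(u,pu), s(v,pv)) / Z`, (2) the `f∘curve`-integral is
within `2‖f‖(1 − P(⊆ Λ'))` of the Duminil-Copin–Smirnov `f`-average of `Λ'`, and (3) bad-curve
events of mass `≤ η P(⊆ Λ')` have DCS weight `≤ η Z_{Λ'}` in `Λ'`. -/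
theorem stub_carvedReduction_conditioning :
    ∀ (Ω : Set ℂ) (δ : ℝ) (S : Set HexVertex) (Λ' : Finset HexVertex) (u v pu pv : HexVertex),
      Finite (HexDomainSAW Ω δ u v) → IsProbabilityMeasure (carvedLaw Ω δ S u v) →
      (∀ x ∈ Λ', x ∉ S) → (∀ x ∈ Λ', ∀ y ∈ Λ', hexGraph.Adj x y → (hexDomainGraph Ω δ).Adj x y) →
      u ∈ Λ' → pu ∈ S → pv ∈ S → hexGraph.Adj u pu → s(u, pu) ≠ s(v, pv) →
      carvedLaw Ω δ S u v {ξ | ∀ x ∈ ξ.walk.support, x ∈ Λ'} =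
          (carvedWeight Ω δ S u v Set.univ)⁻¹ *
            ENNReal.ofReal (∑ γ : HexMidEdgeSAW Λ' s(u, pu) s(v, pv), hexCriticalFugacity ^ γ.length) ∧
      (∀ f : CurveClass ℂ →ᵇ ℝ, Nonempty (HexMidEdgeSAW Λ' s(u, pu) s(v, pv)) →
        |(∫ ξ, f ξ.curve ∂(carvedLaw Ω δ S u v)) -
            (∑ γ : HexMidEdgeSAW Λ' s(u, pu) s(v, pv), hexCriticalFugacity ^ γ.length *
                f (CurveClass.mk ⟨polyline (γ.verts.map fun w => (δ : ℂ) * hexCenter w)⟩)) /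
              ∑ γ : HexMidEdgeSAW Λ' s(u, pu) s(v, pv), hexCriticalFugacity ^ γ.length| ≤
          2 * ‖f‖ * (1 - (carvedLaw Ω δ S u v {ξ | ∀ x ∈ ξ.walk.support, x ∈ Λ'}).toReal)) ∧
      (∀ (𝒞 : Set (CurveClass ℂ)) (η : ℝ), 0 ≤ η →
        carvedLaw Ω δ S u v {ξ | ξ.curve ∉ 𝒞} ≤
          ENNReal.ofReal η * carvedLaw Ω δ S u v {ξ | ∀ x ∈ ξ.walk.support, x ∈ Λ'} →
        (∑ γ : HexMidEdgeSAW Λ' s(u, pu) s(v, pv),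
            if CurveClass.mk ⟨polyline (γ.verts.map fun w => (δ : ℂ) * hexCenter w)⟩ ∉ 𝒞
            then hexCriticalFugacity ^ γ.length else 0) ≤
          η * ∑ γ : HexMidEdgeSAW Λ' s(u, pu) s(v, pv), hexCriticalFugacity ^ γ.length) := by
  intro Ω δ S Λ' u v pu pv hfin hP hΛ'S hedge hu hpu hpv hadj hne
  haveI := hfin
  haveI := Fintype.ofFinite (HexDomainSAW Ω δ u v)
  exact ⟨carvedLaw_subfamily_apply hΛ'S hedge hu hpu hpv hadj hne,
    fun f hne' => abs_integral_curve_sub_div_le hΛ'S hedge hu hpu hpv hadj hne f hne',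
    fun 𝒞 η hη h => sum_ite_notMem_le_of_carvedLaw_le hΛ'S hedge hu hpu hpv hadj hne 𝒞 hη h⟩

end Summit.CriticalPhenomena.SAWScalingLimit.Theorems.ObservableToSLE.TypeLadder

end
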